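import Literature.AlgebraicTopology.Homotopy.WangSequence
import Literature.AlgebraicTopology.Homotopy.PathFibration
import Literature.AlgebraicTopology.SingularHomology.SuspensionIsomorphism
import HarnessLib

/-!
# The cohomology of the loop space of a sphere: `H^{q+(n-1)}(ΩSⁿ; R) ≅ Hᵠ(ΩSⁿ; R)` and vanishing in between

J.-P. Serre, *Homologie singulière des espaces fibrés* (1951), Ch. IV §1, Prop. 1 (homology of the
loop space of a sphere); G. W. Whitehead, *Elements of Homotopy Theory* (1978), Ch. VII §7, the
first application of the Wang sequence (Cor. 7.16 area); A. Hatcher, *Spectral Sequences in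
Algebraic Topology*, Ch. 1, Example 1.5. Statement proved here, for every commutative ring `R`
and `n = k + 2 ≥ 2`: with `ΩSⁿ` realised as the fibre over `v` of the path fibration
`P_v Sⁿ → Sⁿ` (paths from `v`, `PathSpace`), Wang's derivation
`D : H^{i+(k+1)}(ΩSⁿ; R) → Hⁱ(ΩSⁿ; R)` is BIJECTIVE for every `i` (`D_bijective`, `DEquiv`;
the total space is contractible, so both ends of the Wang sequence vanish), `Hᵠ(ΩSⁿ; R) = 0`
for `0 < q < n - 1` (`isZero_of_lt`) and hence `Hᵠ(ΩSⁿ; R) = 0` unless `(n-1) ∣ q`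
(`isZero_of_not_dvd`), while `H^{j(n-1)}(ΩSⁿ; R) ≅ H⁰(ΩSⁿ; R) ≅ H⁰(P_v Sⁿ; R)` (`iterEquiv`,
`map_fibIncl_bijective_zero`). The multiplicative structure (divided powers for `n` odd) follows
from the derivation property of `D` and is not recorded here. Everything is proved; no named fact.

## References

* J.-P. Serre, *Homologie singulière des espaces fibrés. Applications*, Ann. of Math. 54 (1951),
  Ch. IV §1, Prop. 1. [Serre1951]
* G. W. Whitehead, *Elements of Homotopy Theory*, GTM 61, Springer (1978), Ch. VII §7. [Whitehead1978]
* A. Hatcher, *Algebraic Topology*, CUP (2002), §4.3 p. 408 (path fibration). [HatcherAT2002]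
-/

noncomputable section

open Set Function CategoryTheory
open Literature.AlgebraicTopology.SingularHomology

namespace Literature.AlgebraicTopology.Homotopy

/-- Local notation: `𝕊 n` is the unit sphere in `EuclideanSpace ℝ (Fin (n + 1))`. -/
local notation "𝕊 " n:arg => (Metric.sphere (0 : EuclideanSpace ℝ (Fin (n + 1))) 1)

namespace LoopSphere

variable (R : Type) [CommRing R] {k : ℕ} (P : Wang.Poles k)

/-- The path space `P_v Sᵏ⁺²` of paths from `v`. [cite: HatcherAT2002, §4.3 p. 408] -/
abbrev Paths : Type := PathSpace (𝕊 (k + 2)) P.v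

/-- The end-point map `P_v Sᵏ⁺² → Sᵏ⁺²`. [cite: HatcherAT2002, §4.3 p. 408] -/
abbrev ev : Paths P → 𝕊 (k + 2) := MappingPath.endPt

/-- The end-point map is a Hurewicz fibration. [cite: HatcherAT2002, §4.3 Prop. 4.64] -/
theorem hp : IsHurewiczFibration.{0, 0, 0} (ev P) := PathSpace.isHurewiczFibration_endPt P.v

/-- The end-point map is a Serre fibration. [cite: HatcherAT2002, §4.3 Prop. 4.64] -/
theorem hpS : IsSerreFibration (ev P) := PathSpace.isSerreFibration_endPt P.v

/-- **The loop space `ΩSᵏ⁺²`**: paths from `v` to `v` (the fibre of the path fibration over `v`).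
[cite: HatcherAT2002, §4.3 p. 408] -/
abbrev Loops : Type := Wang.Fib P (ev P)

/-- Positive-degree classes of the (contractible) path space vanish. [cite: HatcherAT2002, §3.1 p. 201] -/
theorem paths_eq_zero {n : ℕ} (hn : n ≠ 0) (x : singularCohomology R R (Paths P) n) : x = 0 :=
  ModuleCat.eq_zero_of_isZero_obj (isZero_singularCohomology_of_contractibleSpace R R (Paths P) hn) x

/-- **Wang's derivation `D : H^{i+(k+1)}(ΩSᵏ⁺²) → Hⁱ(ΩSᵏ⁺²)` is bijective** (the Wang sequence of
the path fibration, whose total space is contractible). [cite: Serre1951, Ch. IV §1, Prop. 1]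
[cite: Whitehead1978, Ch. VII §7] -/
theorem D_bijective (i : ℕ) : Bijective (Wang.D R P (hp P) (hpS P) i) := by
  constructor
  · rw [injective_iff_map_eq_zero]
    intro y hy
    obtain ⟨x, rfl⟩ := (Wang.mem_range_iff_D_eq_zero R P (hp P) (hpS P) i y).2 hy
    rw [paths_eq_zero R P (by omega) x, map_zero]
  · intro b
    exact (Wang.lam_eq_zero_iff R P (hp P) (hpS P) i b).1 (paths_eq_zero R P (by omega) _)

/-- **`H^{i+(k+1)}(ΩSᵏ⁺²; R) ≃ Hⁱ(ΩSᵏ⁺²; R)`** (Wang's derivation). [cite: Serre1951, Ch. IV §1, Prop. 1] -/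
def DEquiv (i : ℕ) : singularCohomology R R (Loops P) (i + (k + 1)) ≃ₗ[R] singularCohomology R R (Loops P) i :=
  LinearEquiv.ofBijective (Wang.D R P (hp P) (hpS P) i) (D_bijective R P i)

/-- **`Hᵠ(ΩSᵏ⁺²; R) = 0` for `0 < q < k + 1`** (below the connectivity `ΩSᵏ⁺²` has the cohomology
of the contractible path space). [cite: Serre1951, Ch. IV §1, Prop. 1] -/
theorem eq_zero_of_lt {q : ℕ} (h0 : q ≠ 0) (hq : q < k + 1) (y : singularCohomology R R (Loops P) q) : y = 0 := by
  obtain ⟨x, rfl⟩ := (Wang.map_fibIncl_bijective_of_lt R P (hp P) (hpS P) hq).2 y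
  rw [paths_eq_zero R P h0 x, map_zero]

/-- **`H⁰(ΩSᵏ⁺²; R) ≅ H⁰(P_v Sᵏ⁺²; R)`** (restriction from the contractible path space).
[cite: Whitehead1978, Ch. VII §7] -/
theorem map_fibIncl_bijective_zero :
    Bijective (singularCohomology.map R R (Wang.fibIncl P (ev P)) 0) :=
  Wang.map_fibIncl_bijective_of_lt R P (hp P) (hpS P) (Nat.succ_pos k)

/-- Transport of cohomology along an equality of degrees. [folklore] -/
def castEquiv {X : Type} [TopologicalSpace X] {m n : ℕ} (h : m = n) :
    singularCohomology R R X m ≃ₗ[R] singularCohomology R R X n := by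
  subst h
  exact LinearEquiv.refl R _

/-- **Periodicity: `H^{i + j(k+1)}(ΩSᵏ⁺²; R) ≃ Hⁱ(ΩSᵏ⁺²; R)`** (iterate `D`). [cite: Serre1951, Ch. IV §1, Prop. 1] -/
def iterEquiv (i : ℕ) : (j : ℕ) → singularCohomology R R (Loops P) (i + j * (k + 1)) ≃ₗ[R] singularCohomology R R (Loops P) i
  | 0 => castEquiv R (by ring)
  | j + 1 => (castEquiv R (show i + (j + 1) * (k + 1) = (i + j * (k + 1)) + (k + 1) by ring)).trans
      ((DEquiv R P (i + j * (k + 1))).trans (iterEquiv i j))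

/-- **`Hᵠ(ΩSᵏ⁺²; R) = 0` unless `(k+1) ∣ q`.** [cite: Serre1951, Ch. IV §1, Prop. 1] -/
theorem eq_zero_of_not_dvd {q : ℕ} (hq : ¬ (k + 1) ∣ q) (y : singularCohomology R R (Loops P) q) : y = 0 := by
  -- write `q = r + j (k+1)` with `0 < r < k + 1`
  obtain ⟨j, r, hr, rfl⟩ : ∃ j r, r < k + 1 ∧ q = r + j * (k + 1) :=
    ⟨q / (k + 1), q % (k + 1), Nat.mod_lt _ (Nat.succ_pos k), by rw [Nat.mul_comm]; exact (Nat.mod_add_div q (k + 1)).symm⟩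
  have hr0 : r ≠ 0 := by
    rintro rfl
    exact hq ⟨j, by rw [Nat.zero_add, Nat.mul_comm]⟩
  have h := eq_zero_of_lt R P hr0 hr (iterEquiv R P r j y)
  rwa [LinearEquiv.map_eq_zero_iff] at h

end LoopSphere

end Literature.AlgebraicTopology.Homotopy
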